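import Literature.MathematicalPhysics.QuantumFieldTheory.FermiFlavourPhase
import Literature.MathematicalPhysics.QuantumLattice.GrassmannMonomialCoefficients
import HarnessLib

/-!
# Products of gauge-invariant local lattice-QCD observables

`QCDLatticeObservable N_f R` (Osterwalder–Seiler 1978 §2, as typed in `QCDOS.lean`) is the type of
gauge-invariant local observables of lattice QCD with quark content in the box of radius `R`:
cylinder functions of the `ℤ⁴` gauge field with values in the boxed Grassmann algebra, jointly gauge
invariant, with bounded measurable Grassmann coefficients.  Its docstring promises "all Wilson loops,
all mesons and baryons, **and their products**", but only the linear structure (`+`, `•`, `−`) was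
constructed.  This file supplies the multiplicative structure:

* `QCDLatticeObservable.instMul` — the pointwise product `(A * B).F U = A.F U * B.F U` (link support
  the union).  Gauge invariance is `map_mul` of the algebra automorphism `fermiGaugeAct g`; the
  substance is that bounded measurable coefficients are closed under products, proved by expanding
  the second factor on the finite monomial basis `grassmannBasis` and reading its coordinates through
  the non-degenerate Berezin pairing (`berezin_mul_grassmannBasis_compl`: `∫ x θ_{sᶜ} = ±x_s`).
* `QCDLatticeObservable.instMonoid` — with the unit observable `one`; so finite ordered products
  `(List.ofFn A).prod` (multi-meson operators `Π_a (ψ̄ Γ ψ)(x_a)`, meson × Wilson loop, …) are observables.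
* `onTorus_mul`, `onTorus_list_prod` — placement on a torus is multiplicative (it is an algebra map).
* `IsFlavourCharged.mul`, `IsFlavourCharged.ofFn_prod` — `U(1)_{f₀}` flavour charges ADD under products.

Sources: K. Osterwalder, E. Seiler, Ann. Phys. 110 (1978) 440, §2 (the algebra of gauge-invariant
local observables); I. Montvay, G. Münster, *Quantum Fields on a Lattice* (CUP 1994), §4.1.3
(4.20)–(4.21) (Grassmann coefficients via the Berezin integral), §5.1.1 (5.6) (flavour symmetry).
Not here: adjoints / reflection (see `QCDTimeReflection.osAdjoint`), commutation signs between
observables of odd Grassmann degree (the product is the ordered one).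
-/

noncomputable section

namespace Literature.MathematicalPhysics.QuantumFieldTheory

open Literature.MathematicalPhysics.QuantumLattice Literature.Probability.LatticeModels GrassmannAlgebra

variable {Nf R : ℕ}

namespace QCDLatticeObservable

/-- Two observables with the same observable function and the same declared link support are equal
(the remaining fields are proofs). [folklore] -/
theorem ext' {A B : QCDLatticeObservable Nf R} (hF : A.F = B.F) (hs : A.supp = B.supp) : A = B := by
  obtain ⟨FA, sA, _, _, _, _⟩ := A
  obtain ⟨FB, sB, _, _, _, _⟩ := B
  cases hF
  cases hs
  rfl

/-- **Coordinates of an observable on the Grassmann monomial basis are bounded in the gauge field**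
(`‖x_s‖ = ‖∫ x θ_{sᶜ}‖`, Montvay–Münster (4.21), and the structure field `bounded`). [cite: MontvayMunster1994, §4.1.3 (4.21)] -/
theorem exists_norm_repr_le (A : QCDLatticeObservable Nf R)
    (s : Finset (BoxFermiIdx Nf R ⊕ₗ BoxFermiIdx Nf R)) :
    ∃ C : ℝ, ∀ U : LGConfig 4 (Matrix.specialUnitaryGroup (Fin 3) ℂ),
      ‖(grassmannBasis ℂ (BoxFermiIdx Nf R ⊕ₗ BoxFermiIdx Nf R)).repr (A.F U) s‖ ≤ C := by
  obtain ⟨C, hC⟩ := A.bounded (grassmannBasis ℂ (BoxFermiIdx Nf R ⊕ₗ BoxFermiIdx Nf R) sᶜ)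
  exact ⟨C, fun U => by rw [norm_repr_grassmannBasis]; exact hC U⟩

/-- **Coordinates of an observable on the Grassmann monomial basis are measurable in the gauge field**
(`∫ x θ_{sᶜ} = ε_s x_s` with `ε_s = ±1`, and the structure field `measurable`). [cite: MontvayMunster1994, §4.1.3 (4.21)] -/
theorem measurable_repr (A : QCDLatticeObservable Nf R)
    (s : Finset (BoxFermiIdx Nf R ⊕ₗ BoxFermiIdx Nf R)) :
    Measurable fun U : LGConfig 4 (Matrix.specialUnitaryGroup (Fin 3) ℂ) =>
      (grassmannBasis ℂ (BoxFermiIdx Nf R ⊕ₗ BoxFermiIdx Nf R)).repr (A.F U) s := by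
  -- `∫ x θ_{sᶜ} = σ x_s` with `σ = ±1` (the complement and its sign are taken from the lemma itself)
  have hunit : ∀ u : ℤˣ, ((u : ℤ) : ℂ) = 1 ∨ ((u : ℤ) : ℂ) = -1 := fun u => by
    rcases Int.units_eq_one_or u with h | h <;> simp [h]
  obtain ⟨t, σ, hσ, ht⟩ : ∃ (t : Finset (BoxFermiIdx Nf R ⊕ₗ BoxFermiIdx Nf R)) (σ : ℂ),
      (σ = 1 ∨ σ = -1) ∧ ∀ x : BoxFermiAlg Nf R,
        berezin ℂ (BoxFermiIdx Nf R ⊕ₗ BoxFermiIdx Nf R)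
            (x * grassmannBasis ℂ (BoxFermiIdx Nf R ⊕ₗ BoxFermiIdx Nf R) t) =
          σ * (grassmannBasis ℂ (BoxFermiIdx Nf R ⊕ₗ BoxFermiIdx Nf R)).repr x s :=
    ⟨_, _, hunit _, fun x => berezin_mul_grassmannBasis_compl ℂ x s⟩
  have hσσ : σ * σ = 1 := by rcases hσ with h | h <;> simp [h]
  have heq : (fun U : LGConfig 4 (Matrix.specialUnitaryGroup (Fin 3) ℂ) =>
      (grassmannBasis ℂ (BoxFermiIdx Nf R ⊕ₗ BoxFermiIdx Nf R)).repr (A.F U) s) =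
      fun U => σ * berezin ℂ (BoxFermiIdx Nf R ⊕ₗ BoxFermiIdx Nf R)
        (A.F U * grassmannBasis ℂ (BoxFermiIdx Nf R ⊕ₗ BoxFermiIdx Nf R) t) := by
    funext U
    rw [ht, ← mul_assoc, hσσ, one_mul]
  rw [heq]
  exact (A.measurable _).const_mul σ

/-- Expansion of a triple product along the monomial basis of the MIDDLE factor:
`x · y · z = Σ_s y_s • (x · (θ_s · z))`. [folklore] -/
theorem mul_mul_eq_sum_repr (x y z : BoxFermiAlg Nf R) :
    x * y * z = ∑ s, (grassmannBasis ℂ (BoxFermiIdx Nf R ⊕ₗ BoxFermiIdx Nf R)).repr y s •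
      (x * (grassmannBasis ℂ (BoxFermiIdx Nf R ⊕ₗ BoxFermiIdx Nf R) s * z)) := by
  conv_lhs => rw [← (grassmannBasis ℂ (BoxFermiIdx Nf R ⊕ₗ BoxFermiIdx Nf R)).sum_repr y]
  rw [Finset.mul_sum, Finset.sum_mul]
  refine Finset.sum_congr rfl fun s _ => ?_
  rw [mul_smul_comm, smul_mul_assoc, mul_assoc]

/-- **The product of two gauge-invariant local observables** (same quark box): pointwise product in the
boxed Grassmann algebra, link support the union.  Jointly gauge invariant because `fermiGaugeAct g` is an
algebra automorphism; bounded measurable coefficients by expanding the second factor on the monomial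
basis (finitely many bounded measurable coordinates, `exists_norm_repr_le` / `measurable_repr`).
Osterwalder–Seiler's algebra of observables is closed under products by definition; this is its typed
form. [cite: OsterwalderSeiler1978, §2] -/
instance instMul : Mul (QCDLatticeObservable Nf R) where
  mul A B :=
    { F := fun U => A.F U * B.F U
      supp := A.supp ∪ B.supp
      isCylinder := fun U V hUV => by
        change A.F U * B.F U = A.F V * B.F V
        rw [A.isCylinder fun e he => hUV e (Finset.mem_union_left _ he),
          B.isCylinder fun e he => hUV e (Finset.mem_union_right _ he)]
      gaugeInvariant := fun g U => by rw [map_mul, A.gaugeInvariant, B.gaugeInvariant]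
      bounded := fun y => by
        classical
        choose C hC using fun s : Finset (BoxFermiIdx Nf R ⊕ₗ BoxFermiIdx Nf R) =>
          A.bounded (grassmannBasis ℂ (BoxFermiIdx Nf R ⊕ₗ BoxFermiIdx Nf R) s * y)
        choose D hD using fun s : Finset (BoxFermiIdx Nf R ⊕ₗ BoxFermiIdx Nf R) =>
          B.exists_norm_repr_le s
        refine ⟨∑ s, D s * C s, fun U => ?_⟩
        rw [mul_mul_eq_sum_repr, map_sum]
        refine (norm_sum_le _ _).trans (Finset.sum_le_sum fun s _ => ?_)
        rw [map_smul, norm_smul]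
        exact mul_le_mul (hD s U) (hC s U) (norm_nonneg _) ((norm_nonneg _).trans (hD s U))
      measurable := fun y => by
        classical
        have heq : (fun U : LGConfig 4 (Matrix.specialUnitaryGroup (Fin 3) ℂ) =>
            berezin ℂ (BoxFermiIdx Nf R ⊕ₗ BoxFermiIdx Nf R) (A.F U * B.F U * y)) =
            fun U => ∑ s, (grassmannBasis ℂ (BoxFermiIdx Nf R ⊕ₗ BoxFermiIdx Nf R)).repr (B.F U) s *
              berezin ℂ (BoxFermiIdx Nf R ⊕ₗ BoxFermiIdx Nf R)
                (A.F U * (grassmannBasis ℂ (BoxFermiIdx Nf R ⊕ₗ BoxFermiIdx Nf R) s * y)) := by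
          funext U
          rw [mul_mul_eq_sum_repr, map_sum]
          simp only [map_smul, smul_eq_mul]
        rw [heq]
        exact Finset.measurable_sum _ fun s _ => (B.measurable_repr s).mul (A.measurable _) }

/-- The observable function of a product is the product. [folklore] -/
@[simp] theorem mul_F (A B : QCDLatticeObservable Nf R) (U : LGConfig 4 (Matrix.specialUnitaryGroup (Fin 3) ℂ)) :
    (A * B).F U = A.F U * B.F U := rfl

/-- The declared link support of a product is the union. [folklore] -/
@[simp] theorem mul_supp (A B : QCDLatticeObservable Nf R) : (A * B).supp = A.supp ∪ B.supp := rfl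

/-- The unit observable as `1`. [folklore] -/
instance instOne : One (QCDLatticeObservable Nf R) := ⟨one Nf R⟩

/-- `1` is the unit observable `one`. [folklore] -/
theorem one_def : (1 : QCDLatticeObservable Nf R) = one Nf R := rfl

/-- The unit observable is the constant `1`. [folklore] -/
@[simp] theorem one_F (U : LGConfig 4 (Matrix.specialUnitaryGroup (Fin 3) ℂ)) : (1 : QCDLatticeObservable Nf R).F U = 1 := rfl

/-- The unit observable reads no link. [folklore] -/
@[simp] theorem one_supp : (1 : QCDLatticeObservable Nf R).supp = ∅ := rfl

/-- **Gauge-invariant local observables form a monoid** under the pointwise (ordered) product, so every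
finite ordered product `(List.ofFn A).prod` of observables — multi-hadron operators, hadron × Wilson
loop — is again an observable. [cite: OsterwalderSeiler1978, §2] -/
instance instMonoid : Monoid (QCDLatticeObservable Nf R) where
  mul_assoc A B C := ext' (funext fun U => mul_assoc _ _ _) (Finset.union_assoc _ _ _)
  one_mul A := ext' (funext fun U => one_mul _) (Finset.empty_union _)
  mul_one A := ext' (funext fun U => mul_one _) (Finset.union_empty _)

/-- The observable function of a list product is the ordered product of the observable functions. [folklore] -/
theorem list_prod_F (l : List (QCDLatticeObservable Nf R)) (U : LGConfig 4 (Matrix.specialUnitaryGroup (Fin 3) ℂ)) :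
    l.prod.F U = (l.map fun A => A.F U).prod := by
  induction l with
  | nil => rfl
  | cons A l ih => rw [List.prod_cons, List.map_cons, List.prod_cons, mul_F, ih]

/-- **Placement on a torus is multiplicative**: `(A * B)` placed at `v` is `A` placed at `v` times `B`
placed at `v` (the placement is the algebra map induced on generators). [folklore] -/
theorem onTorus_mul (A B : QCDLatticeObservable Nf R) (S : ℕ) [NeZero S]
    (v : Literature.Probability.LatticeModels.Site 4) (U : GaugeConfig 4 S (Matrix.specialUnitaryGroup (Fin 3) ℂ)) :
    (A * B).onTorus S v U = A.onTorus S v U * B.onTorus S v U := by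
  simp only [onTorus, mul_F, map_mul]

/-- The unit observable placed anywhere is `1`. [folklore] -/
@[simp] theorem onTorus_one (S : ℕ) [NeZero S] (v : Literature.Probability.LatticeModels.Site 4)
    (U : GaugeConfig 4 S (Matrix.specialUnitaryGroup (Fin 3) ℂ)) : (1 : QCDLatticeObservable Nf R).onTorus S v U = 1 :=
  map_one _

/-- Placement of a list product is the ordered product of the placements. [folklore] -/
theorem onTorus_list_prod (l : List (QCDLatticeObservable Nf R)) (S : ℕ) [NeZero S]
    (v : Literature.Probability.LatticeModels.Site 4) (U : GaugeConfig 4 S (Matrix.specialUnitaryGroup (Fin 3) ℂ)) :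
    l.prod.onTorus S v U = (l.map fun A => A.onTorus S v U).prod := by
  induction l with
  | nil => exact onTorus_one S v U
  | cons A l ih => rw [List.prod_cons, List.map_cons, List.prod_cons, onTorus_mul, ih]

/-- Placement of an `ofFn` product. [folklore] -/
theorem onTorus_ofFn_prod {r : ℕ} (A : Fin r → QCDLatticeObservable Nf R) (S : ℕ) [NeZero S]
    (v : Literature.Probability.LatticeModels.Site 4) (U : GaugeConfig 4 S (Matrix.specialUnitaryGroup (Fin 3) ℂ)) :
    (List.ofFn A).prod.onTorus S v U = (List.ofFn fun a => (A a).onTorus S v U).prod := by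
  rw [onTorus_list_prod, List.map_ofFn]
  rfl

/-- **Flavour charges add under products**: if `A ↦ e^{iq_Aθ}A` and `B ↦ e^{iq_Bθ}B` under `U(1)_{f₀}`
then `A B ↦ e^{i(q_A+q_B)θ} A B` (the rotation is an algebra automorphism). [cite: MontvayMunster1994, §5.1.1 (5.6)] -/
theorem IsFlavourCharged.mul {A B : QCDLatticeObservable Nf R} {f₀ : Fin Nf} {qA qB : ℤ}
    (hA : A.IsFlavourCharged f₀ qA) (hB : B.IsFlavourCharged f₀ qB) :
    (A * B).IsFlavourCharged f₀ (qA + qB) := by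
  intro θ U
  rw [mul_F, map_mul, hA θ U, hB θ U, smul_mul_smul_comm, ← Complex.exp_add]
  congr 1
  push_cast
  ring

/-- The unit observable `1` is neutral under every `U(1)_{f₀}`. [folklore] -/
theorem isFlavourCharged_one' (f₀ : Fin Nf) : (1 : QCDLatticeObservable Nf R).IsFlavourCharged f₀ 0 :=
  isFlavourCharged_one f₀

/-- **The charge of an ordered product is the sum of the charges.** [cite: MontvayMunster1994, §5.1.1 (5.6)] -/
theorem IsFlavourCharged.ofFn_prod {f₀ : Fin Nf} :
    ∀ {r : ℕ} (A : Fin r → QCDLatticeObservable Nf R) (q : Fin r → ℤ),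
      (∀ a, (A a).IsFlavourCharged f₀ (q a)) → (List.ofFn A).prod.IsFlavourCharged f₀ (∑ a, q a)
  | 0, A, q, _ => by
    rw [List.ofFn_zero, List.prod_nil, Finset.univ_eq_empty, Finset.sum_empty]
    exact isFlavourCharged_one' f₀
  | r + 1, A, q, h => by
    rw [List.ofFn_succ, List.prod_cons, Fin.sum_univ_succ]
    exact (h 0).mul (IsFlavourCharged.ofFn_prod (fun a => A a.succ) (fun a => q a.succ) fun a => h a.succ)

end QCDLatticeObservable

end Literature.MathematicalPhysics.QuantumFieldTheory
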